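import Mathlib

/-!
# Helper (positive, for the lead's `stub_entropyVolume_of_entropyEnergy`): the one-variable core of the
# Legendre step, WITHOUT case split in `τ`

`4τE − 2 log(1 + E/3) ≥ 2 − 12τ + 2 log(6τ)` for all `τ > 0`, `E ≥ 0`: put `z := 6τ(1 + E/3) > 0`; then
`RHS − LHS = 2(z − 1 − log z) ≥ 0` by `log z ≤ z − 1`.  (So the `τ ≤ 1/6` / `τ > 1/6` branches of the
skeleton's docstring are unnecessary.)  Plus the `τ`-cancellation `2 log(6τ) − 2 log(4πτ) = −2 log(2π/3)`.
drefute refuter-drefute-stmt-SmoothPoincare4-10871-0, 2026-08-16.  Mathlib only.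
-/

namespace DrefuteLegendre

theorem legendre_core {τ E : ℝ} (hτ : 0 < τ) (hE : 0 ≤ E) :
    2 - 12 * τ + 2 * Real.log (6 * τ) ≤ 4 * τ * E - 2 * Real.log (1 + E / 3) := by
  have hx : 0 < 1 + E / 3 := by positivity
  have hz : 0 < 6 * τ * (1 + E / 3) := by positivity
  have hlog : Real.log (6 * τ * (1 + E / 3)) ≤ 6 * τ * (1 + E / 3) - 1 :=
    Real.log_le_sub_one_of_pos hz
  have hsplit : Real.log (6 * τ * (1 + E / 3)) = Real.log (6 * τ) + Real.log (1 + E / 3) :=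
    Real.log_mul (by positivity) hx.ne'
  have hexp : 6 * τ * (1 + E / 3) = 6 * τ + 2 * (τ * E) := by ring
  have h4 : 4 * τ * E = 4 * (τ * E) := by ring
  have hlog' : Real.log (6 * τ) + Real.log (1 + E / 3) ≤ 6 * τ + 2 * (τ * E) - 1 := by
    have h := hlog
    rw [hsplit, hexp] at h
    exact h
  rw [h4]
  linarith

/-- The `τ`-cancellation: `2 log(6τ) − 2 log(4πτ) = −2 log(2π/3)`. -/
theorem tau_cancellation {τ : ℝ} (hτ : 0 < τ) :
    2 * Real.log (6 * τ) - 2 * Real.log (4 * Real.pi * τ) = -(2 * Real.log (2 * Real.pi / 3)) := by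
  have hπ : 0 < Real.pi := Real.pi_pos
  have h1 : Real.log (6 * τ) = Real.log 6 + Real.log τ := Real.log_mul (by norm_num) hτ.ne'
  have h2 : Real.log (4 * Real.pi * τ) = Real.log 4 + Real.log Real.pi + Real.log τ := by
    rw [Real.log_mul (by positivity) hτ.ne', Real.log_mul (by norm_num) hπ.ne']
  have h3 : Real.log (2 * Real.pi / 3) = Real.log 2 + Real.log Real.pi - Real.log 3 := by
    rw [Real.log_div (by positivity) (by norm_num), Real.log_mul (by norm_num) hπ.ne']
  have h6 : Real.log 6 = Real.log 2 + Real.log 3 := by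
    rw [show (6 : ℝ) = 2 * 3 by norm_num, Real.log_mul (by norm_num) (by norm_num)]
  have h4 : Real.log 4 = 2 * Real.log 2 := by
    rw [show (4 : ℝ) = 2 ^ 2 by norm_num, Real.log_pow]; push_cast; ring
  rw [h1, h2, h3, h6, h4]
  ring

/-- The assembled lower bound of the Legendre step: if `Ent ≤ 2 log(1 + E/3)` and
`W = 12τ·r + 4τE − Ent + log V − 2 log(4πτ) − 4` with `r ≥ 1` (i.e. `∫ τ R u ≥ 12τ`), then
`W ≥ log V − 2 log(2π/3) − 2`. -/
theorem legendre_floor {τ E Ent V r W : ℝ} (hτ : 0 < τ) (hE : 0 ≤ E)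
    (hEnt : Ent ≤ 2 * Real.log (1 + E / 3)) (hr : 1 ≤ r)
    (hW : 12 * τ * r + 4 * τ * E - Ent + Real.log V - 2 * Real.log (4 * Real.pi * τ) - 4 ≤ W) :
    Real.log V - 2 * Real.log (2 * Real.pi / 3) - 2 ≤ W := by
  have h1 := legendre_core hτ hE
  have h2 := tau_cancellation hτ
  have h3 : 12 * τ ≤ 12 * τ * r := by nlinarith
  linarith

end DrefuteLegendre
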